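import Summits.NavierStokesRegularity.OSWSelfSimilar.SheetRLinearisedStabilityEvenRecord
import Summits.NavierStokesRegularity.OSWSelfSimilar.SheetRGeneratorEvenSmoothDomain
import Summits.NavierStokesRegularity.OSWSelfSimilar.SheetRSpectrumEvenEndToEnd
import HarnessLib

/-!
# SHEET-ℝ, Z3-SR-SPEC EVEN half: «LINEARLY STABLE MODULO TRANSLATION» AT THE CERTIFIED ZERO `Ω*` — composed down to the hypotheses of the even
# spectral word at the (D2) interface (frame `L = 8`, `a = 1/5`, `λ = θ = 4`, `β₀ = 3/100`), in BOTH forms of the regularity price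

HONEST FRAMING (cell ns-blowup GROUP B / zone Z3, case Z3-SR-SPEC EVEN half, HYPOTHESIS-LEDGER v2.3/v2.4 row (P10)⁺, RECORD-INTERFACE half; renewal route of
memo `HOME/profile/cert/cert5/P9-P10-RENEWAL-DESIGN.md` v2 on the even zero-mass class; 0 kit; 1-D MODEL certificate frame (viscous gCLM/OSW sheet on the line);
computer-assisted inputs are HYPOTHESES; not Euler/NS; «violates: none — MODEL»). NOTHING here asserts that a hypothesis holds. This file is COMPOSITION ONLY —
the even twin of cert-5 g7's `SheetRLinearisedStabilityEndToEnd` (lead g9 letter (mr): seat ns-blowup-profile-cert-1 g10; the interface tier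
`SheetRLinearisedStabilityEvenRecord` is selfsim g17's). It feeds selfsim g17's `exists_flow_sub_translationMode_le_of_pointDataE` (the word on the S2⁺ interface,
existence form: S2⁺ point records + far datum + conjugation symmetry + (P8⁺) allowance + ONE eigenvector at `1/2` + the domain binder `h⁺ ∈ D(T⁺*)`) with
EXACTLY the inputs of cert-5 g9's (D2) `SheetRSpectrumEvenEndToEnd.eigen_set_eq_singleton_of_record`: the (S1⁺) datum at the centre `Ω̄` moved to `Ω*` by
(P8⁺) + re-encoding (`gardingDataKE_star_of_centre`, constants `(c − Δ⁺, m − Δ⁺/4)`), `hsym`/`hpert`/`hv0`/`hv1` DISCHARGED there (`evansEven_symm_of_record`,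
`evansEven_pert_star`, `translationMode_of_record`: the eigenvector at `1/2` is the translation mode `Ω*′` of the weak zero of record).
RESULT, two forms:
* `flow_stable_even_of_centre` — modulo (i) (S1⁺) `hS1` at the centre with `c ≥ c₂`, `m ≥ c₁ + γ`, (ii) `‖u‖_E ≤ rE♯₂` with `Ω* = Ω̄ + prim (der u)`,
  (iii) implementation 2's `PointDataE` + `MixedFarDatum` + `‖h⁺+0i‖² ≤ hw2E` BY NAME, (iv) the weak zero of record with `Ω*(X₀) ≠ 0` — THE SAME LIST AS THE EVEN
  SPECTRAL WORD — plus (v) the explicit regularity binder `hdom : h⁺+0i ∈ D(T⁺*)` (base point `1/2`), for every `0 < β′ < 3/100`: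
  **the linearised even flow `S_F = e^{t(T⁺* + 4⟪h⁺+0i,·⟫(h⁺+0i))}` of `−DG⁺(Ω*)|E⁺₀` exists (C₀-semigroup, unique by its generator; with the coercive semigroup
  `S` of `T⁺*`, `‖S(τ)‖ ≤ e^{−(m−Δ⁺/4)τ}`, Laplace transform `R⁺*`) and every orbit satisfies
  `‖S_F(t)δ₀ − (4⟪h⁺+0i, R⁺*(1/2)δ₀⟫/E⁺*′(1/2))·e^{t/2}·R⁺*(1/2)(h⁺+0i)‖ ≤ M‖δ₀‖e^{−β′t}`** — «LINEARLY STABLE MODULO TRANSLATION (MODEL)» at `Ω*`;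
* `flow_stable_even_of_centre_of_smooth` — (v) DISCHARGED by cert-1 g10's `SheetRGeneratorEvenSmoothDomain.realE_mem_domain_generatorEven_half_of_smooth`
  for any `C²` representative `φ` of `h⁺` (even, `∫φ = 0`, weights `∫w φ², ∫w φ′², ∫w (ξφ′)², ∫w φ″² < ∞`) — e.g. a finite even-coframe sum.
WHY (v) IS A PRICE AT ALL: the far datum `hFD` of the spectral word lives at the CENTRE resolvent `resolventEven … hS1` (implementation 2's arithmetic), the
flow at the STAR datum; selfsim g16's `mem_domain_generatorEven_of_mixedFarDatum` reads `f ∈ D(T⁺)` off a far datum only when the two share the datum.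
No definition, no named fact, no instance, no notation; no number of record moves. WHAT THIS IS NOT: not NS; not a proof that any hypothesis holds; the
ofRecord literal specialisation (`centreOfRecord`, `liftEOfRecord`) and the (P10)⁺ booking are other pens'.
-/

noncomputable section

namespace Summit.NavierStokesRegularity.OSWSelfSimilar
namespace SheetRLinearisedStabilityEvenEndToEnd

open _root_.MeasureTheory _root_.Set _root_.Filter _root_.Real Literature.Analysis.Fourier SheetRWeakProfilePV SheetRWeakToStrong
  SheetREnergyClass SheetRWeightedMeasure SheetREnergySpace SheetRLinearisedTests SheetRTestSpace SheetRLinearisedFormBounds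
  SheetRSolutionOperator SheetRComplexPivot SheetRAssemblyOperators SheetRCertificateAssembly SheetREvenTests SheetREvenEnergySpace
  SheetREvenForms SheetREvenPairUniqueness SheetREvenResolvent SheetREvenClass SheetRResolventEvenClass SheetRGeneratorEvenWeak SheetREvansEven
  SheetREvenAssemblyOperators SheetREvenSecondVariation SheetREvenEnergySpaceOf SheetRTranslationModeWeakEigen SheetREvenCentreReencoding
  SheetREvenLinearisationPerturbation SheetRSpectrumStepRule SheetRSpectrumEvenWindingLists SheetRSpectrumEvenPointCertificate
  SheetRSpectrumEvenPointAssembly SheetRSpectrumEvenAssembly SheetRResolventEvenConj SheetRWeakEigenReal SheetRGeneratorBasePoint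
  SheetRLinearisedSemigroup SheetRLinearisedSemigroupEven SheetRLinearisedStabilityEven SheetRLinearisedStabilityEvenRecord
  SheetRGeneratorEvenSmoothDomain SheetRSpectrumEvenEndToEnd Literature.Analysis.OperatorTheory Literature.Analysis.UnboundedOperators Complex
open scoped Topology ENNReal ContDiff InnerProductSpace ComplexConjugate NNReal

section Record

open CertificateViscousSheetRSpectrum (c1 c2 gamma)
open CertificateViscousSheetRSpectrumEven (DeltaE hw2E)
open CertificateViscousSheetR (rEsharp2)

variable {h8 : (0 : ℝ) < 8} [CompleteSpace (WcevenZ h8)] {Ω Ω₁ Ωs Ωs₁ : ℝ → ℝ} {H₀ Hs : ℝ}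
  (hc : IsCentre 8 Ω Ω₁ H₀) (hcs : IsCentre 8 Ωs Ωs₁ Hs) (u : Esp 8 h8) (hsum : ∀ y, Ωs y = Ω y + prim (der u) y)
  {hE : W 8} (hhE : hE ∈ WevenZ h8) {D₀ D₁ V₀ c m : ℝ}
  (hS1 : GardingDataKE 8 h8 (drift (1 / 5) Ω) (potential 8 4 Ω)
    (-PopCE h8 4 (1 / 5) hc + (((4 : ℝ) • ((innerSL ℝ hE).comp (ιEE h8))).smulRight hE)) D₀ D₁ V₀ c m)
  (hc2 : ((c2 : ℚ) : ℝ) ≤ c) (hm : ((c1 : ℚ) : ℝ) + ((gamma : ℚ) : ℝ) ≤ m) (hu : ‖u‖ ≤ (rEsharp2 : ℝ))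
  (hPD : PointDataE (resolventEven h8 _ hS1) (realE h8 hE hhE) (realE h8 hE hhE) 4
    (evansEven h8 _ hS1 (innerSL ℂ (realE h8 hE hhE)) (realE h8 hE hhE) 4))
  (hFD : MixedFarDatum (resolventEven h8 _ hS1) (realE h8 hE hhE) (realE h8 hE hhE) 1 ((10075811313 : ℝ) / 10000000000)
    ((754639259 : ℝ) / 200000000) ((1011518153 : ℝ) / 250000000) ((4049925993 : ℝ) / 1000000000))
  (hhw : ‖realE h8 hE hhE‖ ^ 2 ≤ ((hw2E : ℚ) : ℝ))
  (hweak : ∀ ψ : ℝ → ℝ, ContDiff ℝ ∞ ψ → HasCompactSupport ψ →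
    (∫ x, (Ωs x + 1 / 2 * x * Ωs₁ x + 1 / 5 * (∫ s in (0 : ℝ)..x, hilbertTransform Ωs s) * Ωs₁ x
      - hilbertTransform Ωs x * Ωs x) * ψ x) + ∫ x, Ωs₁ x * deriv ψ x = 0)
  {X₀ : ℝ} (hX₀ : Ωs X₀ ≠ 0)

include hm hPD hFD hhw hweak hX₀ in
/-- **«LINEARLY STABLE MODULO TRANSLATION» (MODEL, even class) AT `Ω*`, composed from the centre datum — THE SAME HYPOTHESIS LIST AS THE EVEN SPECTRAL
WORD `SheetRSpectrumEvenEndToEnd.eigen_set_eq_singleton_of_record` plus the regularity binder `hdom : h⁺+0i ∈ D(T⁺*)`.** Frame `L = 8`, `a = 1/5`, `λ = θ = 4`,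
`h⁺` a real even zero-mass `L²_w` class; `T⁺* := generatorEven` of the `Ω*`-encoding with the DERIVED datum `gardingDataKE_star_of_centre` (constants
`(c − Δ⁺, m − Δ⁺/4)`), `R⁺* := resolventEven` there, `E⁺* := evansEven … ⟪h⁺+0i,·⟫ (h⁺+0i) 4`. Modulo (S1⁺) `hS1` at the centre `Ω̄` with `c ≥ c₂`,
`m ≥ c₁ + γ`, the existence row `‖u‖_E ≤ rE♯₂` with `Ω* = Ω̄ + prim (der u)`, the interval records `hPD`/`hFD`/`hhw` BY NAME, the weak zero of record `hweak`
with `Ω*(X₀) ≠ 0`, and `hdom`: for every `0 < β′ < 3/100` the linearised even flow `S_F = e^{t(T⁺* + 4⟪h⁺+0i,·⟫(h⁺+0i))}` of `−DG⁺(Ω*)|E⁺₀` EXISTS (with the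
coercive semigroup `S` of `T⁺*`, `‖S(τ)‖ ≤ e^{−(m−Δ⁺/4)τ}`, Laplace transform `R⁺*`; base point `‖(4⟪h⁺+0i,·⟫)·(h⁺+0i)‖`) and every orbit satisfies
`‖S_F(t)δ₀ − (4⟪h⁺+0i, R⁺*(1/2)δ₀⟫/E⁺*′(1/2))·e^{t/2}·R⁺*(1/2)(h⁺+0i)‖ ≤ M‖δ₀‖e^{−β′t}` — the word «LINEARLY STABLE MODULO TRANSLATION (MODEL)» at `Ω*`.
MODEL statement; not NS; nothing is asserted to hold. [folklore] -/
theorem flow_stable_even_of_centre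
    (hdom : realE h8 hE hhE ∈ (generatorEven h8 _ (gardingDataKE_star_of_centre hc hcs u hsum hS1 hc2 hu) ((1 : ℂ) / 2)
      (lt_trans (neg_mstar_lt_ra' hm) ra_lt_half_re)).domain)
    {β' : ℝ} (hβ' : 0 < β') (hβ'3 : β' < (3 : ℝ) / 100) :
    ∃ (S SF : C0Semigroup ℂ (WcevenZ h8))
      (hσ₀ : -(m - ((DeltaE : ℚ) : ℝ) / 4) <
        (((‖((4 : ℂ) • innerSL ℂ (realE h8 hE hhE)).smulRight (realE h8 hE hhE)‖ : ℝ) : ℂ)).re),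
      S.generator = generatorEven h8 _ (gardingDataKE_star_of_centre hc hcs u hsum hS1 hc2 hu) _ hσ₀ ∧
      (∀ τ : ℝ≥0, ‖S.app τ‖ ≤ Real.exp (-(m - ((DeltaE : ℚ) : ℝ) / 4) * τ)) ∧
      (∀ σ : ℂ, -(m - ((DeltaE : ℚ) : ℝ) / 4) < σ.re → ∀ G : WcevenZ h8,
        S.laplaceResolventFun σ G = resolventEven h8 _ (gardingDataKE_star_of_centre hc hcs u hsum hS1 hc2 hu) σ G) ∧
      ((SF.generator.domain : Set (WcevenZ h8)) =
        (generatorEven h8 _ (gardingDataKE_star_of_centre hc hcs u hsum hS1 hc2 hu) _ hσ₀).domain) ∧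
      (∀ (w : WcevenZ h8) (hw : w ∈ (generatorEven h8 _ (gardingDataKE_star_of_centre hc hcs u hsum hS1 hc2 hu) _ hσ₀).domain),
        ∃ hw' : w ∈ SF.generator.domain,
          SF.generator ⟨w, hw'⟩ = generatorEven h8 _ (gardingDataKE_star_of_centre hc hcs u hsum hS1 hc2 hu) _ hσ₀ ⟨w, hw⟩ +
            ((4 : ℂ) * innerSL ℂ (realE h8 hE hhE) w) • realE h8 hE hhE) ∧
      ∃ M : ℝ, ∀ (δ₀ : WcevenZ h8) (t : ℝ), 0 ≤ t →
        ‖SF.app t.toNNReal δ₀ -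
          ((deriv (evansEven h8 _ (gardingDataKE_star_of_centre hc hcs u hsum hS1 hc2 hu) (innerSL ℂ (realE h8 hE hhE))
              (realE h8 hE hhE) 4) (1 / 2))⁻¹ *
              ((4 : ℂ) * innerSL ℂ (realE h8 hE hhE)
                (resolventEven h8 _ (gardingDataKE_star_of_centre hc hcs u hsum hS1 hc2 hu) (1 / 2) δ₀)) * (Real.exp (t / 2) : ℂ)) •
            resolventEven h8 _ (gardingDataKE_star_of_centre hc hcs u hsum hS1 hc2 hu) (1 / 2) (realE h8 hE hhE)‖ ≤
          M * ‖δ₀‖ * Real.exp (-β' * t) := by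
  obtain ⟨hpert, hpert'⟩ := evansEven_pert_star hc hcs u hsum hhE hS1 hc2 hm hu hhw
  obtain ⟨P, -, hv0, hv1⟩ := translationMode_of_record hc hcs u hsum hhE hS1 hc2 hm hu hweak hX₀
  have hθ : ‖(4 : ℂ)‖ ≤ 4 := by simp
  exact exists_flow_sub_translationMode_le_of_pointDataE h8 _ hS1 _ (gardingDataKE_star_of_centre hc hcs u hsum hS1 hc2 hu)
    (three_twentieths_le_m hm) (neg_mstar_lt_ra' hm) (realE h8 hE hhE) (4 : ℂ) hθ (evansEven_symm_of_record hc hhE hS1) hpert hpert' hPD hFD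
    hv0 hv1 hdom hβ' hβ'3

include hm hPD hFD hhw hweak hX₀ in
/-- **«LINEARLY STABLE MODULO TRANSLATION» (MODEL, even class) AT `Ω*` — regularity price DISCHARGED at function level.** As
`flow_stable_even_of_centre`, with the binder `hdom : h⁺+0i ∈ D(T⁺*)` replaced by a `C²` representative `φ` of the class `h⁺` (`h⁺ = φ` a.e.) that is
even with `∫ φ = 0` and has the four weights `∫w φ², ∫w φ′², ∫w (ξφ′)², ∫w φ″² < ∞` (`w = 64 + ξ²`) — every finite even-coframe sum is such a `φ`
(cert-1 g10 `SheetRGeneratorEvenSmoothDomain.realE_mem_domain_generatorEven_half_of_smooth`, valid for EVERY (S1⁺) datum, here the star datum).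
Hypotheses otherwise = the (D2) interface list of the even spectral word. MODEL statement; not NS; nothing is asserted to hold. [folklore] -/
theorem flow_stable_even_of_centre_of_smooth
    {φ : ℝ → ℝ} (hφ : ContDiff ℝ 2 φ) (heven : ∀ y, φ (-y) = φ y) (hz : ∫ y, φ y = 0)
    (hw0 : Integrable fun y => ((8 : ℝ) ^ 2 + y ^ 2) * φ y ^ 2) (hw1 : Integrable fun y => ((8 : ℝ) ^ 2 + y ^ 2) * deriv φ y ^ 2)
    (hw1' : Integrable fun y => ((8 : ℝ) ^ 2 + y ^ 2) * (y * deriv φ y) ^ 2)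
    (hw2 : Integrable fun y => ((8 : ℝ) ^ 2 + y ^ 2) * deriv (deriv φ) y ^ 2)
    (hEφ : ((hE : W 8) : ℝ → ℝ) =ᵐ[volume] φ)
    {β' : ℝ} (hβ' : 0 < β') (hβ'3 : β' < (3 : ℝ) / 100) :
    ∃ (S SF : C0Semigroup ℂ (WcevenZ h8))
      (hσ₀ : -(m - ((DeltaE : ℚ) : ℝ) / 4) <
        (((‖((4 : ℂ) • innerSL ℂ (realE h8 hE hhE)).smulRight (realE h8 hE hhE)‖ : ℝ) : ℂ)).re),
      S.generator = generatorEven h8 _ (gardingDataKE_star_of_centre hc hcs u hsum hS1 hc2 hu) _ hσ₀ ∧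
      (∀ τ : ℝ≥0, ‖S.app τ‖ ≤ Real.exp (-(m - ((DeltaE : ℚ) : ℝ) / 4) * τ)) ∧
      (∀ σ : ℂ, -(m - ((DeltaE : ℚ) : ℝ) / 4) < σ.re → ∀ G : WcevenZ h8,
        S.laplaceResolventFun σ G = resolventEven h8 _ (gardingDataKE_star_of_centre hc hcs u hsum hS1 hc2 hu) σ G) ∧
      ((SF.generator.domain : Set (WcevenZ h8)) =
        (generatorEven h8 _ (gardingDataKE_star_of_centre hc hcs u hsum hS1 hc2 hu) _ hσ₀).domain) ∧
      (∀ (w : WcevenZ h8) (hw : w ∈ (generatorEven h8 _ (gardingDataKE_star_of_centre hc hcs u hsum hS1 hc2 hu) _ hσ₀).domain),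
        ∃ hw' : w ∈ SF.generator.domain,
          SF.generator ⟨w, hw'⟩ = generatorEven h8 _ (gardingDataKE_star_of_centre hc hcs u hsum hS1 hc2 hu) _ hσ₀ ⟨w, hw⟩ +
            ((4 : ℂ) * innerSL ℂ (realE h8 hE hhE) w) • realE h8 hE hhE) ∧
      ∃ M : ℝ, ∀ (δ₀ : WcevenZ h8) (t : ℝ), 0 ≤ t →
        ‖SF.app t.toNNReal δ₀ -
          ((deriv (evansEven h8 _ (gardingDataKE_star_of_centre hc hcs u hsum hS1 hc2 hu) (innerSL ℂ (realE h8 hE hhE))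
              (realE h8 hE hhE) 4) (1 / 2))⁻¹ *
              ((4 : ℂ) * innerSL ℂ (realE h8 hE hhE)
                (resolventEven h8 _ (gardingDataKE_star_of_centre hc hcs u hsum hS1 hc2 hu) (1 / 2) δ₀)) * (Real.exp (t / 2) : ℂ)) •
            resolventEven h8 _ (gardingDataKE_star_of_centre hc hcs u hsum hS1 hc2 hu) (1 / 2) (realE h8 hE hhE)‖ ≤
          M * ‖δ₀‖ * Real.exp (-β' * t) :=
  flow_stable_even_of_centre hc hcs u hsum hhE hS1 hc2 hm hu hPD hFD hhw hweak hX₀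
    (realE_mem_domain_generatorEven_half_of_smooth h8 _ (gardingDataKE_star_of_centre hc hcs u hsum hS1 hc2 hu)
      (lt_trans (neg_mstar_lt_ra' hm) ra_lt_half_re) hφ heven hz hw0 hw1 hw1' hw2 hEφ hhE) hβ' hβ'3

end Record

end SheetRLinearisedStabilityEvenEndToEnd
end Summit.NavierStokesRegularity.OSWSelfSimilar

end
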